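import Mathlib
import HarnessLib
import Literature.Analysis.FluidPDE.ClassicalSolutionGalilean
import Summits.NavierStokesRegularity.NavierStokesRegularity.Theorems.UnthreadedDoorAntidynamoWallAntiTwin

/-!
# Route `UnthreadedDoor` / `ThreadingFlux`, crux `PoloidalLiouville` (stmt-NavierStokesRegularity-1222), antidynamo v2 skeleton (4ebf5683127b),
# WALL `stub_scalarLiouville`: ANTI-TWINS WITH DRIFT — every ANTI-SYMMETRIC sector is trivial, with NO condition on the centre velocity

Support file (seat leafhand-ns-unthreadeddoor-2 g1, cell decomp-ns), `--supports stmt-NavierStokesRegularity-1222 --as helper`; theorems only.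
p816757 closed the `R`-anti-symmetric sectors under `R v(t,x₀) = −v(t,x₀)`; this file removes that condition.  An **anti-twin** `u` (class member with
OPPOSITE vorticity) is `u = k(t) − v`, `k(t) = u(t,x₀) + v(t,x₀)` (`antiTwin_eq_const_sub`); the two vorticity equations give the DRIFT–HEAT EQUATION
`∂ₜω = Δω − ½ Dω[k(t)]` (`timeDerivWithin_vorticity_eq_of_antiTwin`); in the Galilean frame `x = y + a(t)`, `a' = ½k`, the translated vorticity is a
bounded `C²` ancient caloric field, hence constant (`Literature.Analysis.PDE.heat_liouville`), and a constant field tangent to the spheres about `x₀`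
vanishes (`curl_eq_zero_of_driftCaloric_unthreaded`).
* ★★★ `curl_eq_zero_of_curl_antisymmetric` — class + unthreaded about `x₀` + `curl v(t)(x₀ + R y) = −det R • R (curl v(t)(x₀ + y))` at every `t < 0`
  (a linear isometry `R`) ⇒ `curl v ≡ 0`; instances: odd potentials (`R = −1`, p799093), MIRROR-EVEN (vector-even) vorticity, vorticity reversed by the
  rotation by `π` about an axis through `x₀`; `constant_…`; the wall's letter `stubScalarLiouville_of_antisymmetric_potential` (`T(t,x₀+Ry) = −T(t,x₀+y)`).
MEANING: for EVERY linear isometry `R` both parities are settled — `R`-symmetric ⇒ irrotational ∨ exactly `R`-equivariant (p816327); `R`-anti-symmetric ⇒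
irrotational (here).  HONEST LABEL: nothing here proves `stub_scalarLiouville`, `PoloidalLiouville` (1222), or bears on Navier–Stokes regularity; no summit
statement is proved (crux 1222 is INCOMPARABLE with the summit). [folklore] [cite: KochNadirashviliSereginSverak2009, Thm 5.2 (arXiv:0709.3599 pp. 9–10)]
-/

noncomputable section

-- the summit and its single sub-problem share the name (CONVENTIONS §1)
set_option linter.dupNamespace false

open scoped Topology InnerProductSpace RealInnerProductSpace ContDiff Laplacian
open Filter Set Function Metric MeasureTheory
open Literature.Analysis.FluidPDE

namespace Summit.NavierStokesRegularity.NavierStokesRegularity.Theorems.PoloidalLiouville.Antidynamo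

open Summit.NavierStokesRegularity.NavierStokesRegularity.Theorems.PoloidalLiouville
  (constantOfIrrotational vorticityOfClass exists_norm_curl_le)
open Summit.NavierStokesRegularity.FluidComputer.AngularLadder (det_symm_eq_det)

/-! ### Anti-twins differ from `−v` by their drift -/

/-- **OPPOSITE VORTICITY ⇒ `u = k(t) − v`** with `k(t) = u(t,x₀) + v(t,x₀)` (the sum is a bounded curl- and divergence-free `C²` field).
[folklore] -/
theorem antiTwin_eq_const_sub
    {v u : ℝ → EuclideanSpace ℝ (Fin 3) → EuclideanSpace ℝ (Fin 3)} (x₀ : EuclideanSpace ℝ (Fin 3))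
    (hB : Literature.Analysis.FluidPDE.IsBoundedAncientMildSolution 1 v)
    (hsm : ContDiffOn ℝ (⊤ : ℕ∞) (Function.uncurry v) (Set.Iio 0 ×ˢ Set.univ))
    (hBu : Literature.Analysis.FluidPDE.IsBoundedAncientMildSolution 1 u)
    (hsmu : ContDiffOn ℝ (⊤ : ℕ∞) (Function.uncurry u) (Set.Iio 0 ×ˢ Set.univ))
    (hcu : ∀ s < 0, ∀ x, curl (u s) x = -curl (v s) x) :
    ∀ s < 0, ∀ y, u s y = (u s x₀ + v s x₀) - v s y := by
  have hsm' : IsSmoothSpaceTimeOn (Iio 0) v := hsm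
  have hsmu' : IsSmoothSpaceTimeOn (Iio 0) u := hsmu
  obtain ⟨M, hM⟩ := hB.isBoundedOn
  obtain ⟨Mu, hMu⟩ := hBu.isBoundedOn
  intro s hs y
  have hvs : ContDiff ℝ ∞ (v s) := hsm'.contDiff_slice hs
  have hus : ContDiff ℝ ∞ (u s) := hsmu'.contDiff_slice hs
  have hv2 : ContDiff ℝ 2 (v s) := hvs.of_le (by norm_cast)
  have hu2 : ContDiff ℝ 2 (u s) := hus.of_le (by norm_cast)
  set W : EuclideanSpace ℝ (Fin 3) → EuclideanSpace ℝ (Fin 3) := fun y => u s y + v s y with hW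
  have hW2 : ContDiff ℝ 2 W := hu2.add hv2
  have hud : ∀ y, DifferentiableAt ℝ (u s) y := fun y => (hu2.differentiable (by norm_num)) y
  have hvd : ∀ y, DifferentiableAt ℝ (v s) y := fun y => (hv2.differentiable (by norm_num)) y
  have hWcurl : ∀ y, curl W y = 0 := fun y => by
    rw [hW, curl_add (hud y) (hvd y), hcu s hs y, neg_add_cancel]
  have hdivv : VectorCalculus.IsDivFree (v s) :=
    (hB.isAncientMildSolution.1 s hs).isDivFree_of_contDiff (hvs.of_le (by norm_cast))
  have hdivu : VectorCalculus.IsDivFree (u s) :=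
    (hBu.isAncientMildSolution.1 s hs).isDivFree_of_contDiff (hus.of_le (by norm_cast))
  have hWdiv : VectorCalculus.IsDivFree W := by
    intro y
    have h1 := hdivu y
    have h2 := hdivv y
    simp only [VectorCalculus.divergence] at h1 h2 ⊢
    rw [hW, fderiv_fun_add (hud y) (hvd y), ContinuousLinearMap.toLinearMap_add, map_add, h1, h2, add_zero]
  have hWb : ∀ y, ‖W y‖ ≤ Mu + M := fun y => (norm_add_le _ _).trans (add_le_add (hMu s hs y) (hM s hs y))
  have hWy : W y = W x₀ := eq_of_curl_eq_zero_of_isDivFree_of_bounded hW2 hWcurl hWdiv hWb y x₀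
  have : u s y + v s y = u s x₀ + v s x₀ := hWy
  exact eq_sub_of_add_eq this

/-! ### The drift–heat equation of an anti-twin pair -/

/-- **`v` AND `k(t) − v` BOTH SOLVE THE VORTICITY FORMULATION ⇒ `∂ₜω = Δω − ½ Dω[k(t)]`.** [folklore] -/
theorem timeDerivWithin_vorticity_eq_of_antiTwin
    {v u : ℝ → EuclideanSpace ℝ (Fin 3) → EuclideanSpace ℝ (Fin 3)}
    (hV : IsVorticitySolutionOn (Iio 0) 1 v) (hU : IsVorticitySolutionOn (Iio 0) 1 u)
    (k : ℝ → EuclideanSpace ℝ (Fin 3)) (hanti : ∀ s < 0, ∀ y, u s y = k s - v s y) {t : ℝ} (ht : t < 0)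
    (x : EuclideanSpace ℝ (Fin 3)) :
    timeDerivWithin (Iio 0) (vorticity v) t x =
      (Δ (vorticity v t)) x - (1 / 2 : ℝ) • fderiv ℝ (vorticity v t) x (k t) := by
  have E1 := hV.vorticity_eq t ht x
  have E2 := hU.vorticity_eq t ht x
  have hfun : ∀ s < 0, u s = fun y => k s - v s y := fun s hs => funext (hanti s hs)
  have hcurl : ∀ s < 0, ∀ y, curl (u s) y = -curl (v s) y := fun s hs y => by
    rw [hfun s hs, curl_eq_curlCLM, curl_eq_curlCLM, fderiv_const_sub, map_neg]
  have ha : timeDerivWithin (Iio 0) (vorticity u) t x = -timeDerivWithin (Iio 0) (vorticity v) t x := by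
    rw [timeDerivWithin_apply, timeDerivWithin_apply]
    have hcongr : derivWithin (fun s => vorticity u s x) (Iio 0) t = derivWithin (-fun s => vorticity v s x) (Iio 0) t :=
      derivWithin_congr (fun s hs => by simp only [vorticity_apply, Pi.neg_apply]; exact hcurl s hs x)
        (by simp only [vorticity_apply, Pi.neg_apply]; exact hcurl t ht x)
    rw [hcongr, derivWithin.neg]
  have hωfun : vorticity u t = -vorticity v t := by
    funext y; rw [vorticity_apply, Pi.neg_apply, vorticity_apply]; exact hcurl t ht y
  have hb1 : fderiv ℝ (vorticity u t) x = -fderiv ℝ (vorticity v t) x := by rw [hωfun, fderiv_neg]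
  have hb2 : fderiv ℝ (u t) x = -fderiv ℝ (v t) x := by
    rw [hfun t ht]
    exact fderiv_const_sub (k t)
  have hconv1 : convect (u t) (vorticity u t) x =
      convect (v t) (vorticity v t) x - fderiv ℝ (vorticity v t) x (k t) := by
    simp only [convect, hb1, hanti t ht x, _root_.neg_apply, map_sub]
    abel
  have hconv2 : convect (vorticity u t) (u t) x = convect (vorticity v t) (v t) x := by
    simp only [convect, hb2, hωfun, Pi.neg_apply, _root_.neg_apply, map_neg, neg_neg]
  have hc : (Δ (vorticity u t)) x = -(Δ (vorticity v t)) x := by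
    rw [hωfun, InnerProductSpace.laplacian_neg, Pi.neg_apply]
  rw [ha, hconv1, hconv2, hc, one_smul] at E2
  rw [one_smul] at E1
  -- E1 : T + A = B + L ;  E2 : -T + (A - D) = B + -L
  set T := timeDerivWithin (Iio 0) (vorticity v) t x
  set A := convect (v t) (vorticity v t) x
  set B := convect (vorticity v t) (v t) x
  set L := (Δ (vorticity v t)) x
  set D := fderiv ℝ (vorticity v t) x (k t)
  have h1 : T = B + L - A := eq_sub_of_add_eq E1
  have h3 : T = A - D - (B + -L) := by
    have h4 : -T = B + -L - (A - D) := eq_sub_of_add_eq E2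
    have h5 : T = -(B + -L - (A - D)) := by rw [← h4, neg_neg]
    rw [h5]; abel
  have h5 : (2 : ℝ) • T = (2 : ℝ) • L - D := by
    rw [two_smul, two_smul]
    nth_rewrite 1 [h1]
    rw [h3]
    abel
  calc T = (1 / 2 : ℝ) • ((2 : ℝ) • T) := by rw [smul_smul]; norm_num
    _ = (1 / 2 : ℝ) • ((2 : ℝ) • L - D) := by rw [h5]
    _ = L - (1 / 2 : ℝ) • D := by rw [smul_sub, smul_smul]; norm_num

/-! ### A bounded drift-caloric vorticity tangent to spheres vanishes (Galilean frame + heat Liouville) -/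

/-- **A BOUNDED VORTICITY SOLVING `∂ₜω = Δω − ½ Dω[k(t)]` WITH A SMOOTH SPATIALLY CONSTANT DRIFT, TANGENT TO THE SPHERES ABOUT A POINT, VANISHES.**
In the Galilean frame `y ↦ y + a(t)`, `a' = ½k`, the translated vorticity solves the heat equation on the open past slab; by
`Literature.Analysis.PDE.heat_liouville` it is one constant, and a constant field tangent to the spheres about `x₀` is zero. [folklore] -/
theorem curl_eq_zero_of_driftCaloric_unthreaded
    {v : ℝ → EuclideanSpace ℝ (Fin 3) → EuclideanSpace ℝ (Fin 3)} (hV : IsVorticitySolutionOn (Iio 0) 1 v)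
    {K : ℝ} (hK : ∀ t < 0, ∀ x, ‖curl (v t) x‖ ≤ K) (x₀ : EuclideanSpace ℝ (Fin 3))
    (hun : ∀ t < 0, ∀ x, ⟪x - x₀, curl (v t) x⟫ = 0)
    (k : ℝ → EuclideanSpace ℝ (Fin 3)) (hk : ContDiffOn ℝ ∞ k (Iio 0))
    (hheat : ∀ t < 0, ∀ x, timeDerivWithin (Iio 0) (vorticity v) t x =
      (Δ (vorticity v t)) x - (1 / 2 : ℝ) • fderiv ℝ (vorticity v t) x (k t)) :
    ∀ t < 0, ∀ x, curl (v t) x = 0 := by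
  have hsm : IsSmoothSpaceTimeOn (Iio 0) v := hV.smooth_velocity
  have hsmω : IsSmoothSpaceTimeOn (Iio 0) (vorticity v) := hsm.isSmoothSpaceTimeOn_vorticity isOpen_Iio.uniqueDiffOn
  have hO : IsOpen (Iio (0 : ℝ) ×ˢ (univ : Set (EuclideanSpace ℝ (Fin 3)))) := isOpen_Iio.prod isOpen_univ
  have hωinf : ContDiffOn ℝ ∞ (uncurry (vorticity v)) (Iio (0 : ℝ) ×ˢ univ) := hsmω
  -- the primitive `a` of `½ k` on `(−∞,0)`
  have hkc : ContinuousOn k (Iio 0) := hk.continuousOn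
  set a : ℝ → EuclideanSpace ℝ (Fin 3) := fun t => ∫ s in (-1 : ℝ)..t, (1 / 2 : ℝ) • k s with ha_def
  have hfc : ContinuousOn (fun s => (1 / 2 : ℝ) • k s) (Iio 0) := ContinuousOn.fun_smul continuousOn_const hkc
  have ha : ∀ t < 0, HasDerivAt a ((1 / 2 : ℝ) • k t) t := by
    intro t ht
    have hsub : uIcc (-1 : ℝ) t ⊆ Iio 0 := fun s hs => by
      have h2 := (mem_uIcc.1 hs)
      show s < 0
      rcases h2 with ⟨-, h⟩ | ⟨-, h⟩ <;> linarith
    have hint : IntervalIntegrable (fun s => (1 / 2 : ℝ) • k s) volume (-1) t := (hfc.mono hsub).intervalIntegrable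
    exact intervalIntegral.integral_hasDerivAt_right hint (hfc.stronglyMeasurableAtFilter isOpen_Iio t ht)
      (hfc.continuousAt (Iio_mem_nhds ht))
  have hadiff : DifferentiableOn ℝ a (Iio 0) := fun t ht => (ha t ht).differentiableAt.differentiableWithinAt
  have haderiv : ∀ t < 0, deriv a t = (1 / 2 : ℝ) • k t := fun t ht => (ha t ht).deriv
  have hainf : ContDiffOn ℝ ∞ a (Iio 0) := by
    rw [contDiffOn_infty_iff_deriv_of_isOpen isOpen_Iio]
    refine ⟨hadiff, ?_⟩
    exact (hk.const_smul (1 / 2 : ℝ)).congr fun t ht => haderiv t ht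
  set Φ : ℝ × EuclideanSpace ℝ (Fin 3) → ℝ × EuclideanSpace ℝ (Fin 3) := fun p => (p.1, p.2 + a p.1) with hΦ
  have hΦs : ContDiffOn ℝ ∞ Φ (Iio (0 : ℝ) ×ˢ univ) := by
    have h1 : ContDiffOn ℝ ∞ (fun p : ℝ × EuclideanSpace ℝ (Fin 3) => a p.1) (Iio (0 : ℝ) ×ˢ univ) :=
      hainf.comp contDiff_fst.contDiffOn fun p hp => hp.1
    exact contDiff_fst.contDiffOn.prodMk (contDiff_snd.contDiffOn.add h1)
  have hΦmaps : MapsTo Φ (Iio (0 : ℝ) ×ˢ univ) (Iio (0 : ℝ) ×ˢ univ) := fun p hp => ⟨hp.1, mem_univ _⟩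
  set θ : ℝ → EuclideanSpace ℝ (Fin 3) → EuclideanSpace ℝ (Fin 3) := fun t y => curl (v t) (y + a t) with hθ
  have hθeq : uncurry θ = uncurry (vorticity v) ∘ Φ := by
    funext p
    obtain ⟨t, y⟩ := p
    simp [hθ, hΦ, vorticity_apply]
  have hθinf : ContDiffOn ℝ ∞ (uncurry θ) (Iio (0 : ℝ) ×ˢ univ) := by
    rw [hθeq]
    exact hωinf.comp hΦs hΦmaps
  have hθ2 : ContDiffOn ℝ 2 (uncurry θ) (Iio (0 : ℝ) ×ˢ univ) := hθinf.of_le (by norm_cast)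
  have hω2 : ContDiffOn ℝ 2 (uncurry (vorticity v)) (Iio (0 : ℝ) ×ˢ univ) := hωinf.of_le (by norm_cast)
  -- the heat equation for `θ` in the Carleman frame
  have hheatθ : ∀ z ∈ Iio (0 : ℝ) ×ˢ (univ : Set (EuclideanSpace ℝ (Fin 3))),
      Carleman.dt (uncurry θ) z = Carleman.lap (uncurry θ) z := by
    rintro ⟨t, y⟩ hz
    have ht : t < 0 := (mem_prod.1 hz).1
    set p : EuclideanSpace ℝ (Fin 3) := y + a t with hp
    have hzp : (t, p) ∈ Iio (0 : ℝ) ×ˢ (univ : Set (EuclideanSpace ℝ (Fin 3))) := ⟨ht, mem_univ _⟩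
    have hdθ : DifferentiableAt ℝ (uncurry θ) (t, y) :=
      (hθ2.differentiableOn (by norm_num)).differentiableAt (hO.mem_nhds hz)
    have hdω : DifferentiableAt ℝ (uncurry (vorticity v)) (t, p) :=
      (hω2.differentiableOn (by norm_num)).differentiableAt (hO.mem_nhds hzp)
    have hγ : HasDerivAt (fun s : ℝ => (s, y + a s)) ((1 : ℝ), (1 / 2 : ℝ) • k t) t :=
      (hasDerivAt_id t).prodMk ((ha t ht).const_add y)
    have hcomp : HasDerivAt (uncurry (vorticity v) ∘ fun s : ℝ => (s, y + a s))
        (fderiv ℝ (uncurry (vorticity v)) (t, p) ((1 : ℝ), (1 / 2 : ℝ) • k t)) t := by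
      have hdω' : HasFDerivAt (uncurry (vorticity v)) (fderiv ℝ (uncurry (vorticity v)) (t, p))
          ((fun s : ℝ => (s, y + a s)) t) := by
        simpa only [hp] using hdω.hasFDerivAt
      exact hdω'.comp_hasDerivAt t hγ
    have hsplit : fderiv ℝ (uncurry (vorticity v)) (t, p) ((1 : ℝ), (1 / 2 : ℝ) • k t) =
        timeDeriv (vorticity v) t p + fderiv ℝ (vorticity v t) p ((1 / 2 : ℝ) • k t) := by
      have e : ((1 : ℝ), (1 / 2 : ℝ) • k t) = ((1 : ℝ), (0 : EuclideanSpace ℝ (Fin 3))) + ((0 : ℝ), (1 / 2 : ℝ) • k t) := by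
        simp
      rw [e, map_add, ← Carleman.dt_apply, ← Carleman.dx_apply, Carleman.dt_uncurry hdω, Carleman.dx_uncurry hdω]
    have hdt : Carleman.dt (uncurry θ) (t, y) = timeDeriv (vorticity v) t p + fderiv ℝ (vorticity v t) p ((1 / 2 : ℝ) • k t) := by
      rw [Carleman.dt_uncurry hdθ, Literature.Analysis.FluidPDE.timeDeriv_apply]
      have hfun : (fun s => θ s y) = uncurry (vorticity v) ∘ fun s : ℝ => (s, y + a s) := by
        funext s; simp [hθ, vorticity_apply]
      rw [hfun, hcomp.deriv, hsplit]
    have hlaw : timeDeriv (vorticity v) t p = (Δ (vorticity v t)) p - (1 / 2 : ℝ) • fderiv ℝ (vorticity v t) p (k t) := by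
      rw [Literature.Analysis.FluidPDE.timeDeriv_apply, ← derivWithin_of_isOpen isOpen_Iio ht, ← timeDerivWithin_apply]
      exact hheat t ht p
    have hlap : Carleman.lap (uncurry θ) (t, y) = (Δ (vorticity v t)) p := by
      rw [Carleman.lap_uncurry hO hz hθ2]
      have hfun : θ t = fun z => vorticity v t (z + a t) := by
        funext z; simp [hθ, vorticity_apply]
      rw [hfun, laplacian_comp_add_right]
    rw [hdt, hlaw, hlap, map_smul]
    abel
  -- constancy on the slab
  have key : ∀ t t' : ℝ, t < 0 → t' < 0 → ∀ y y' : EuclideanSpace ℝ (Fin 3), θ t y = θ t' y' := by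
    intro t t' ht ht' y y'
    have h := Literature.Analysis.PDE.heat_liouville (u := uncurry θ) (T := 0) (A := K) (γ := 0) le_rfl
      zero_lt_one hθ2 hheatθ ?_ (z := (t, y)) (w := (t', y')) (mem_prod.2 ⟨ht, mem_univ _⟩)
      (mem_prod.2 ⟨ht', mem_univ _⟩)
    · simpa using h
    · rintro ⟨τ, z⟩ hz
      have hτ : τ < 0 := (mem_prod.1 hz).1
      rw [Real.rpow_zero, mul_one]
      exact hK τ hτ (z + a τ)
  -- a constant field tangent to the spheres about `x₀` vanishes
  intro t ht x
  set c₀ := curl (v t) x with hc₀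
  have hx : θ t (x - a t) = c₀ := by simp [hθ, hc₀]
  have h1 : curl (v t) (x₀ + c₀) = c₀ := by
    have h := key t t ht ht (x₀ + c₀ - a t) (x - a t)
    rw [hx] at h
    simpa [hθ] using h
  have h2 : ⟪x₀ + c₀ - x₀, curl (v t) (x₀ + c₀)⟫ = 0 := hun t ht (x₀ + c₀)
  rw [h1, add_sub_cancel_left] at h2
  exact inner_self_eq_zero.1 h2

/-! ### ★★★ Anti-symmetric vorticity is trivial -/

/-- ★★★ **ANTI-SYMMETRIC VORTICITY ⇒ IRROTATIONAL (no centre condition).**  Let `v` be a bounded ancient mild solution (`ν = 1`, duality class)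
with measurable slices, jointly smooth on `(−∞,0) × ℝ³` and unthreaded about `x₀`; let `R` be a linear isometry.  If at every `t < 0` the vorticity
is ANTI-symmetric as a pseudovector about `x₀` under `R`, `curl v(t)(x₀ + R y) = −(det R • R (curl v(t)(x₀ + y)))`, then `curl v ≡ 0` on
`(−∞,0) × ℝ³`.  [Anti-twin `u = R v(x₀ + R⁻¹(· − x₀)) = k(t) − v`; drift–heat equation; Galilean frame; heat Liouville; tangency.]
[cite: KochNadirashviliSereginSverak2009, Thm 5.2 (arXiv:0709.3599 pp. 9–10)] -/
theorem curl_eq_zero_of_curl_antisymmetric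
    (v : ℝ → EuclideanSpace ℝ (Fin 3) → EuclideanSpace ℝ (Fin 3)) (x₀ : EuclideanSpace ℝ (Fin 3))
    (hB : Literature.Analysis.FluidPDE.IsBoundedAncientMildSolution 1 v)
    (hm : ∀ t < 0, AEStronglyMeasurable (v t) volume)
    (hsm : ContDiffOn ℝ (⊤ : ℕ∞) (Function.uncurry v) (Set.Iio 0 ×ˢ Set.univ))
    (hun : ∀ t < 0, ∀ x, ⟪x - x₀, curl (v t) x⟫ = 0)
    (R : EuclideanSpace ℝ (Fin 3) ≃ₗᵢ[ℝ] EuclideanSpace ℝ (Fin 3))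
    (hanti : ∀ t < 0, ∀ y, curl (v t) (x₀ + R y) =
      -((R : EuclideanSpace ℝ (Fin 3) →L[ℝ] EuclideanSpace ℝ (Fin 3)).det • R (curl (v t) (x₀ + y)))) :
    ∀ t < 0, ∀ x, curl (v t) x = 0 := by
  have hsm' : IsSmoothSpaceTimeOn (Iio 0) v := hsm
  -- the conjugated anti-twin
  set c : EuclideanSpace ℝ (Fin 3) := x₀ - R.symm x₀ with hc
  set u : ℝ → EuclideanSpace ℝ (Fin 3) → EuclideanSpace ℝ (Fin 3) := fun s y => R (v s (R.symm y + c)) with hu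
  have hBu : Literature.Analysis.FluidPDE.IsBoundedAncientMildSolution 1 u := by
    have h := CellFlux.isBoundedAncientMildSolution_frame hB R c (le_refl (0 : ℝ))
    have e : (fun s y => R (v (s + 0) (R.symm y + c))) = u := by
      funext s y
      rw [add_zero]
    rw [e] at h
    exact h
  have hus : ∀ s < 0, ContDiff ℝ ∞ (u s) := fun s hs =>
    R.contDiff.comp ((hsm'.contDiff_slice hs).comp (R.symm.contDiff.add contDiff_const))
  have hmu : ∀ s < 0, AEStronglyMeasurable (u s) volume := fun s hs => (hus s hs).continuous.aestronglyMeasurable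
  have hsmu : ContDiffOn ℝ (⊤ : ℕ∞) (Function.uncurry u) (Set.Iio 0 ×ˢ Set.univ) := by
    have hmap : ContDiff ℝ (⊤ : ℕ∞) fun p : ℝ × EuclideanSpace ℝ (Fin 3) => (p.1, R.symm p.2 + c) :=
      contDiff_fst.prodMk ((R.symm.contDiff.comp contDiff_snd).add contDiff_const)
    have hmaps : MapsTo (fun p : ℝ × EuclideanSpace ℝ (Fin 3) => (p.1, R.symm p.2 + c)) (Iio 0 ×ˢ univ) (Iio 0 ×ˢ univ) :=
      fun p hp => ⟨hp.1, mem_univ _⟩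
    exact R.contDiff.comp_contDiffOn (hsm.comp hmap.contDiffOn hmaps)
  have hcu : ∀ s < 0, ∀ x, curl (u s) x = -curl (v s) x := by
    intro s hs x
    rw [hu, curl_conj_rigidMotion R c (v s) x]
    have e1 : R.symm x + c = x₀ + R.symm (x - x₀) := by
      rw [hc, map_sub]
      abel
    rw [e1]
    have h := hanti s hs (R.symm (x - x₀))
    rw [LinearIsometryEquiv.apply_symm_apply, add_sub_cancel] at h
    rw [h, neg_neg]
  set k : ℝ → EuclideanSpace ℝ (Fin 3) := fun s => u s x₀ + v s x₀ with hk
  have hanti' : ∀ s < 0, ∀ y, u s y = k s - v s y := antiTwin_eq_const_sub x₀ hB hsm hBu hsmu hcu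
  have hcentre : ContDiffOn ℝ ∞ (fun s : ℝ => v s x₀) (Iio 0) :=
    hsm.comp (contDiff_id.prodMk contDiff_const).contDiffOn fun s hs => ⟨hs, mem_univ _⟩
  have hk_smooth : ContDiffOn ℝ ∞ k (Iio 0) := by
    have hux0 : ∀ s, u s x₀ = R (v s x₀) := by
      intro s
      simp only [hu, hc, add_sub_cancel]
    have e : k = fun s => R (v s x₀) + v s x₀ := by funext s; rw [hk]; simp only [hux0]
    rw [e]
    exact (R.contDiff.comp_contDiffOn hcentre).add hcentre
  obtain ⟨hV, K, hK⟩ := vorticityOfClass v hB hm hsm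
  obtain ⟨hU, -⟩ := vorticityOfClass u hBu hmu hsmu
  exact curl_eq_zero_of_driftCaloric_unthreaded hV hK x₀ hun k hk_smooth fun t ht x =>
    timeDerivWithin_vorticity_eq_of_antiTwin hV hU k hanti' ht x

/-- ★★★ **… HENCE SLICE-WISE CONSTANT.** [cite: KochNadirashviliSereginSverak2009, Thm 5.2 (arXiv:0709.3599 pp. 9–10)] -/
theorem constant_of_curl_antisymmetric
    (v : ℝ → EuclideanSpace ℝ (Fin 3) → EuclideanSpace ℝ (Fin 3)) (x₀ : EuclideanSpace ℝ (Fin 3))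
    (hB : Literature.Analysis.FluidPDE.IsBoundedAncientMildSolution 1 v)
    (hm : ∀ t < 0, AEStronglyMeasurable (v t) volume)
    (hsm : ContDiffOn ℝ (⊤ : ℕ∞) (Function.uncurry v) (Set.Iio 0 ×ˢ Set.univ))
    (hun : ∀ t < 0, ∀ x, ⟪x - x₀, curl (v t) x⟫ = 0)
    (R : EuclideanSpace ℝ (Fin 3) ≃ₗᵢ[ℝ] EuclideanSpace ℝ (Fin 3))
    (hanti : ∀ t < 0, ∀ y, curl (v t) (x₀ + R y) =
      -((R : EuclideanSpace ℝ (Fin 3) →L[ℝ] EuclideanSpace ℝ (Fin 3)).det • R (curl (v t) (x₀ + y)))) :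
    ∀ t < 0, ∃ b : EuclideanSpace ℝ (Fin 3), ∀ x, v t x = b :=
  constantOfIrrotational v hB hsm (curl_eq_zero_of_curl_antisymmetric v x₀ hB hm hsm hun R hanti)

/-! ### The wall's letter: anti-symmetric potentials -/

/-- **A potential ANTI-invariant under `y ↦ x₀ + R (y − x₀)` has an `R`-anti-covariant gradient**: if `T(x₀ + R y) = −T(x₀ + y)` for all `y`, then
`∇T(x₀ + R y) = −R (∇T(x₀ + y))` (junk values included, as in `gradient_comp_symmetric`). [folklore] -/
theorem gradient_comp_antisymmetric {T : EuclideanSpace ℝ (Fin 3) → ℝ} {x₀ : EuclideanSpace ℝ (Fin 3)}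
    (R : EuclideanSpace ℝ (Fin 3) ≃ₗᵢ[ℝ] EuclideanSpace ℝ (Fin 3)) (hT : ∀ y, T (x₀ + R y) = -T (x₀ + y)) (y : EuclideanSpace ℝ (Fin 3)) :
    gradient T (x₀ + R y) = -R (gradient T (x₀ + y)) := by
  -- the two chain rules
  have h1 : fderiv ℝ (fun z : EuclideanSpace ℝ (Fin 3) => T (x₀ + R z)) y =
      (fderiv ℝ T (x₀ + R y)).comp (R.toContinuousLinearEquiv : EuclideanSpace ℝ (Fin 3) →L[ℝ] EuclideanSpace ℝ (Fin 3)) := by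
    have e : (fun z : EuclideanSpace ℝ (Fin 3) => T (x₀ + R z)) = (fun w => T (x₀ + w)) ∘ (R.toContinuousLinearEquiv) := by
      funext z; rfl
    rw [e, ContinuousLinearEquiv.comp_right_fderiv, fderiv_comp_add_left]
    rfl
  have h2 : fderiv ℝ (fun z : EuclideanSpace ℝ (Fin 3) => T (x₀ + R z)) y = -fderiv ℝ T (x₀ + y) := by
    have e : (fun z : EuclideanSpace ℝ (Fin 3) => T (x₀ + R z)) = fun z => -T (x₀ + z) := funext hT
    rw [e, fderiv_fun_neg, fderiv_comp_add_left]
  have h3 : ∀ h : EuclideanSpace ℝ (Fin 3), fderiv ℝ T (x₀ + R y) h = -fderiv ℝ T (x₀ + y) (R.symm h) := by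
    intro h
    have := congrArg (fun L : EuclideanSpace ℝ (Fin 3) →L[ℝ] ℝ => L (R.symm h)) (h1.symm.trans h2)
    simpa using this
  -- pass to gradients through the inner product
  apply ext_inner_right ℝ
  intro h
  rw [Literature.Analysis.FluidPDE.inner_gradient_left, h3 h, ← Literature.Analysis.FluidPDE.inner_gradient_left,
    inner_neg_left, ← R.inner_map_map (gradient T (x₀ + y)) (R.symm h), R.apply_symm_apply]

/-- **An `R`-ANTI-invariant potential represents an `R`-ANTI-symmetric vorticity**: `curl (v t) x = ∇T × (x − x₀)` everywhere and
`T(x₀ + R y) = −T(x₀ + y)` ⇒ `curl (v t)(x₀ + R y) = −(det R • R (curl (v t)(x₀ + y)))`. [folklore] -/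
theorem curl_antisymmetric_of_antisymmetric_potential {V : EuclideanSpace ℝ (Fin 3) → EuclideanSpace ℝ (Fin 3)}
    {T : EuclideanSpace ℝ (Fin 3) → ℝ} {x₀ : EuclideanSpace ℝ (Fin 3)}
    (hrep : ∀ x, curl V x = cross (gradient T x) (x - x₀))
    (R : EuclideanSpace ℝ (Fin 3) ≃ₗᵢ[ℝ] EuclideanSpace ℝ (Fin 3)) (hT : ∀ y, T (x₀ + R y) = -T (x₀ + y))
    (y : EuclideanSpace ℝ (Fin 3)) :
    curl V (x₀ + R y) = -((R : EuclideanSpace ℝ (Fin 3) →L[ℝ] EuclideanSpace ℝ (Fin 3)).det • R (curl V (x₀ + y))) := by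
  rw [hrep, hrep, add_sub_cancel_left, add_sub_cancel_left, gradient_comp_antisymmetric R hT y,
    ← Summit.NavierStokesRegularity.FluidComputer.AngularLadder.cross_map_linearIsometryEquiv,
    ← crossCLM_apply, ← crossCLM_apply, map_neg, _root_.neg_apply]

/-- ★★★ **THE WALL'S LETTER: AN ANTI-SYMMETRIC POTENTIAL IS TRIVIAL.**  If the vorticity of the wall's flow is `∇T(t,·) × (· − x₀)` with
`T(t, x₀ + R y) = −T(t, x₀ + y)` for all `t < 0`, `y` (a linear isometry `R`; `R = −1`: odd potentials; a mirror: mirror-odd potentials; …), then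
`∇T × (x − x₀) ≡ 0` on `(−∞,0) × ℝ³`. [cite: KochNadirashviliSereginSverak2009, Thm 5.2 (arXiv:0709.3599 pp. 9–10)] -/
theorem stubScalarLiouville_of_antisymmetric_potential
    (v : ℝ → EuclideanSpace ℝ (Fin 3) → EuclideanSpace ℝ (Fin 3)) (x₀ : EuclideanSpace ℝ (Fin 3))
    (T : ℝ → EuclideanSpace ℝ (Fin 3) → ℝ)
    (hB : Literature.Analysis.FluidPDE.IsBoundedAncientMildSolution 1 v)
    (hm : ∀ t < 0, AEStronglyMeasurable (v t) volume)
    (hsm : ContDiffOn ℝ (⊤ : ℕ∞) (Function.uncurry v) (Set.Iio 0 ×ˢ Set.univ))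
    (hrep : ∀ t < 0, ∀ x, Literature.Analysis.FluidPDE.curl (v t) x =
      Literature.Analysis.FluidPDE.cross (gradient (T t) x) (x - x₀))
    (R : EuclideanSpace ℝ (Fin 3) ≃ₗᵢ[ℝ] EuclideanSpace ℝ (Fin 3))
    (hT : ∀ t < 0, ∀ y, T t (x₀ + R y) = -T t (x₀ + y)) :
    ∀ t < 0, ∀ x, Literature.Analysis.FluidPDE.cross (gradient (T t) x) (x - x₀) = 0 := by
  have hun : ∀ t < 0, ∀ x, ⟪x - x₀, curl (v t) x⟫ = 0 := fun t ht x => by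
    rw [hrep t ht x]
    simp [cross, crossProduct, PiLp.inner_apply, Fin.sum_univ_three]
    ring
  have hanti : ∀ t < 0, ∀ y, curl (v t) (x₀ + R y) =
      -((R : EuclideanSpace ℝ (Fin 3) →L[ℝ] EuclideanSpace ℝ (Fin 3)).det • R (curl (v t) (x₀ + y))) :=
    fun t ht y => curl_antisymmetric_of_antisymmetric_potential (hrep t ht) R (hT t ht) y
  intro t ht x
  rw [← hrep t ht x]
  exact curl_eq_zero_of_curl_antisymmetric v x₀ hB hm hsm hun R hanti t ht x

end Summit.NavierStokesRegularity.NavierStokesRegularity.Theorems.PoloidalLiouville.Antidynamo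

end
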